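import Literature.Analysis.FluidPDE.TaoAveragedEulerFormBound
import Literature.Analysis.FluidPDE.TaoAveragedSlotFourier
import Literature.Analysis.FluidPDE.TaoAveragedComplexAverage
import HarnessLib

/-!
# Tao's averaged Navier–Stokes setting: measurability in `ω` of the averaged Euler integrand

T. Tao, *Finite time blowup for an averaged three-dimensional Navier–Stokes equation*,
J. Amer. Math. Soc. **29** (2016), 601–674 = arXiv:1402.0290v3 (held as `paper:arxiv-1402.0290`),
§1.1 (1.13), p. 6 ("for some probability space `(Ω, μ)` and some measurable maps
`R_{i,·} : Ω → SO(3)`, `λ_{i,·} : Ω → (0,+∞)` and `m_{i,·}(D) : Ω → 𝓜₀`") and §3.1 Def. 3.4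
(3.4), p. 15: the integrand
`ω ↦ ⟨B(m_{1,ω}(D) Rot_{R_{1,ω}} Dil_{λ_{1,ω}} u, m_{2,ω}(D) Rot_{R_{2,ω}} Dil_{λ_{2,ω}} v), m_{3,ω}(D) Rot_{R_{3,ω}} Dil_{λ_{3,ω}} w⟩`
of (1.13)/(3.4) must be measurable for the `Ω`-integral to make sense; the source takes this as
read. Fourth support file of the discharge of the named fact
`Literature.Analysis.FluidPDE.Tao2016.complexAverage_linear_right`
(`TaoAveragedComplexAverage.lean`); it proves that measurability from the pointwise
measurability recorded in the accepted `ComplexAveragingDatum` (`measurable_m` off the origin,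
`measurable_R`, `measurable_lam`):

* `ComplexAveragingDatum.fourierFn_slot_ae_eq` — for each `ω`, the Fourier transform of a slot
  `A_{i,ω} u = m_{i,ω}(D) Rot Dil u` is a.e. the explicit function
  `ξ ↦ m_{i,ω}(ξ) R_ℂ (λ^{-3/2} û(λ⁻¹ R⁻¹ ξ))` (accepted `fourierFn_fourierMultiplier`,
  `fourierFn_rot`, `fourierFn_dil`), with `m` cut off at `ξ = 0`;
* `ComplexAveragingDatum.measurable_symbol_indicator` — `(ω, ξ) ↦ m_{i,ω}(ξ) 1_{ξ ≠ 0}` is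
  jointly measurable: a Carathéodory function (measurable in `ω`, continuous in `ξ ≠ 0`;
  Mathlib's `measurable_uncurry_of_continuous_of_measurable` on the subtype `{ξ ≠ 0}`);
* `ComplexAveragingDatum.measurable_symm_apply`, `….measurable_complexifyCLM_apply` —
  `(ω, ξ) ↦ R_{i,ω}⁻¹ ξ = ∑ⱼ ⟨R_{i,ω} eⱼ, ξ⟩ eⱼ` and `(ω, V) ↦ (R_{i,ω})_ℂ V` are measurable;
* `ComplexAveragingDatum.measurable_fourierSlotFn` — hence `(ω, ξ) ↦ 𝓕(A_{i,ω} u)(ξ)` has a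
  jointly measurable version;
* `ComplexAveragingDatum.aestronglyMeasurable_eulerForm_slot` — **the integrand of (3.4),
  `ω ↦ ⟨B(A_{1,ω} u, A_{2,ω} v), A_{3,ω} w⟩`, is (a.e. strongly) measurable on `Ω`**
  (`StronglyMeasurable.integral_prod_right'` applied to the jointly measurable version of the
  `ℝ⁶`-integrand of (1.3)).

## References

* T. Tao, J. Amer. Math. Soc. 29 (2016), 601–674, arXiv:1402.0290v3, §1.1 (1.13) p. 6,
  §3.1 Def. 3.4 p. 15. Key `Tao2016AveragedNS`.
-/

noncomputable section

open MeasureTheory Set Filter Topology FourierTransform Complex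
open scoped ENNReal NNReal RealInnerProductSpace

namespace Literature.Analysis.FluidPDE.Tao2016

/-- Coordinates of the inverse rotation: `(R⁻¹ξ)ⱼ = ⟨R eⱼ, ξ⟩` (`R⁻¹ = Rᵀ`). [folklore] -/
theorem symm_apply_coord (R : EuclideanSpace ℝ (Fin 3) ≃ₗᵢ[ℝ] EuclideanSpace ℝ (Fin 3))
    (ξ : EuclideanSpace ℝ (Fin 3)) (j : Fin 3) :
    R.symm ξ j = ⟪R (EuclideanSpace.single j (1 : ℝ)), ξ⟫ := by
  have h := EuclideanSpace.inner_single_left j (1 : ℝ) (R.symm ξ)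
  rw [map_one, one_mul] at h
  rw [← h, ← R.inner_map_map, R.apply_symm_apply]

namespace ComplexAveragingDatum

variable (𝒟 : ComplexAveragingDatum) (i : Fin 3)

/-! ### The Fourier transform of a slot, explicitly -/

/-- **The Fourier side of a slot of (3.4)**: for every `ω`,
`𝓕(m_{i,ω}(D) Rot_R Dil_λ u)(ξ) = m_{i,ω}(ξ) · R_ℂ (λ^{-3/2} û(λ⁻¹ R⁻¹ ξ))` for a.e. `ξ`
(Tao p. 6: `\widehat{m(D)u} = m û`, `\widehat{Rot_R u}(ξ) = R û(R⁻¹ξ)`, and (1.11)); the symbol is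
cut off at the null set `{ξ = 0}`, where `𝓜₀ ⊗ ℂ` imposes nothing. [cite: Tao2016AveragedNS, §1.1 p. 6 and Def. 3.4] -/
theorem fourierFn_slot_ae_eq (θ : 𝒟.Ω) (u : L2C) :
    fourierFn (𝒟.slot i θ u) =ᵐ[volume] fun ξ =>
      Set.indicator {0}ᶜ (𝒟.m i θ) ξ •
        complexifyCLM (𝒟.R i θ).toLinearIsometry.toContinuousLinearMap
          (((((𝒟.lam i θ)⁻¹ ^ (3 / 2 : ℝ) : ℝ)) : ℂ) •
            fourierFn u ((𝒟.lam i θ)⁻¹ • (𝒟.R i θ).symm ξ)) := by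
  unfold slot
  have h1 := fourierFn_fourierMultiplier (𝒟.symbolLp i θ)
    (rot (𝒟.R i θ) (dil (𝒟.lam i θ) u))
  have h2 := fourierFn_rot (𝒟.R i θ) (dil (𝒟.lam i θ) u)
  have h3 := (𝒟.R i θ).symm.measurePreserving.quasiMeasurePreserving.ae_eq
    (fourierFn_dil u (𝒟.lam_pos i θ))
  have h4 : ⇑(𝒟.symbolLp i θ) =ᵐ[volume] 𝒟.m i θ := by
    unfold symbolLp
    exact MemLp.coeFn_toLp _
  have h0 : ∀ᵐ ξ ∂(volume : Measure (EuclideanSpace ℝ (Fin 3))), ξ ∈ ({0}ᶜ : Set _) :=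
    compl_mem_ae_iff.mpr (measure_singleton _)
  filter_upwards [h1, h2, h3, h4, h0] with ξ e1 e2 e3 e4 e0
  simp only [Function.comp_apply] at e3
  rw [e1, e2, e3, e4, Set.indicator_of_mem e0]

/-! ### Joint measurability of the data -/

/-- **The random symbol is jointly measurable off the origin**: `(ω, ξ) ↦ m_{i,ω}(ξ) 1_{ξ ≠ 0}`
is measurable on `Ω × ℝ³` — a Carathéodory function (measurable in `ω` for each `ξ ≠ 0`,
continuous in `ξ ≠ 0` for each `ω`). [folklore] -/
theorem measurable_symbol_indicator :
    Measurable fun q : 𝒟.Ω × EuclideanSpace ℝ (Fin 3) => Set.indicator {0}ᶜ (𝒟.m i q.1) q.2 := by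
  set S : Set (EuclideanSpace ℝ (Fin 3)) := {0}ᶜ with hS_def
  have hS : MeasurableSet S := (measurableSet_singleton 0).compl
  -- Carathéodory on the subtype `S`
  have hcar : Measurable (Function.uncurry fun (ξ : S) (θ : 𝒟.Ω) => 𝒟.m i θ ξ) := by
    refine measurable_uncurry_of_continuous_of_measurable (fun θ => ?_) (fun ξ => ?_)
    · exact ((𝒟.isComplexSymbol i θ).1.continuousOn).restrict
    · exact 𝒟.measurable_m i ξ.1 ξ.2
  set T : Set (𝒟.Ω × EuclideanSpace ℝ (Fin 3)) := {q | q.2 ∈ S} with hT_def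
  have hT : MeasurableSet T := measurable_snd hS
  refine measurable_of_restrict_of_restrict_compl hT ?_ ?_
  · have h : T.restrict (fun q : 𝒟.Ω × EuclideanSpace ℝ (Fin 3) =>
        Set.indicator S (𝒟.m i q.1) q.2) =
        (Function.uncurry fun (ξ : S) (θ : 𝒟.Ω) => 𝒟.m i θ ξ) ∘
          fun q : T => ((⟨q.1.2, q.2⟩ : S), q.1.1) := by
      funext q
      have hq : (q : 𝒟.Ω × EuclideanSpace ℝ (Fin 3)).2 ∈ S := q.2
      simp only [Set.restrict_apply, Function.comp_apply, Function.uncurry_apply_pair]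
      exact Set.indicator_of_mem hq (𝒟.m i (q : 𝒟.Ω × EuclideanSpace ℝ (Fin 3)).1)
    rw [h]
    exact hcar.comp (((measurable_snd.comp measurable_subtype_coe).subtype_mk).prodMk
      (measurable_fst.comp measurable_subtype_coe))
  · have h : Tᶜ.restrict (fun q : 𝒟.Ω × EuclideanSpace ℝ (Fin 3) =>
        Set.indicator S (𝒟.m i q.1) q.2) = fun _ => 0 := by
      funext q
      have hq : (q : 𝒟.Ω × EuclideanSpace ℝ (Fin 3)).2 ∉ S := q.2
      rw [Set.restrict_apply]
      exact Set.indicator_of_notMem hq (𝒟.m i (q : 𝒟.Ω × EuclideanSpace ℝ (Fin 3)).1)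
    rw [h]
    exact measurable_const

/-- **The inverse random rotation is jointly measurable**: `(ω, ξ) ↦ R_{i,ω}⁻¹ ξ`
(`= ∑ⱼ ⟨R_{i,ω} eⱼ, ξ⟩ eⱼ`, measurable in `ω`, linear in `ξ`). [folklore] -/
theorem measurable_symm_apply :
    Measurable fun q : 𝒟.Ω × EuclideanSpace ℝ (Fin 3) => (𝒟.R i q.1).symm q.2 := by
  have h : (fun q : 𝒟.Ω × EuclideanSpace ℝ (Fin 3) => (𝒟.R i q.1).symm q.2) =
      fun q => WithLp.toLp 2 fun j => ⟪𝒟.R i q.1 (EuclideanSpace.single j (1 : ℝ)), q.2⟫ := by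
    funext q
    ext j
    rw [PiLp.toLp_apply]
    exact symm_apply_coord _ _ _
  rw [h]
  refine (WithLp.measurable_toLp 2 _).comp (measurable_pi_lambda _ fun j => ?_)
  have hRj : Measurable fun q : 𝒟.Ω × EuclideanSpace ℝ (Fin 3) =>
      𝒟.R i q.1 (EuclideanSpace.single j (1 : ℝ)) :=
    (𝒟.measurable_R i (EuclideanSpace.single j (1 : ℝ))).comp measurable_fst
  exact continuous_inner.measurable.comp (hRj.prodMk measurable_snd)

/-- **The complexified random rotation acts measurably**: if `Φ : Ω × X → ℂ³` is measurable then
so is `(ω, x) ↦ (R_{i,ω})_ℂ Φ(ω, x)` (its coordinates are `∑ₖ (R_{i,ω} eₖ)ⱼ Φₖ`). [folklore] -/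
theorem measurable_complexifyCLM_apply {X : Type*} [MeasurableSpace X]
    {Φ : 𝒟.Ω × X → EuclideanSpace ℂ (Fin 3)} (hΦ : Measurable Φ) :
    Measurable fun q : 𝒟.Ω × X =>
      complexifyCLM (𝒟.R i q.1).toLinearIsometry.toContinuousLinearMap (Φ q) := by
  have h : (fun q : 𝒟.Ω × X =>
      complexifyCLM (𝒟.R i q.1).toLinearIsometry.toContinuousLinearMap (Φ q)) =
      fun q => WithLp.toLp 2 fun j =>
        ∑ k, (((𝒟.R i q.1 (EuclideanSpace.single k (1 : ℝ))) j : ℝ) : ℂ) * Φ q k := by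
    funext q
    ext j
    rw [PiLp.toLp_apply, complexifyCLM_apply]
    rfl
  rw [h]
  refine (WithLp.measurable_toLp 2 _).comp (measurable_pi_lambda _ fun j => ?_)
  refine Finset.measurable_fun_sum _ fun k _ => Measurable.mul ?_ ?_
  · exact Complex.measurable_ofReal.comp ((measurable_pi_apply j).comp
      ((WithLp.measurable_ofLp 2 _).comp ((𝒟.measurable_R i _).comp measurable_fst)))
  · exact (measurable_pi_apply k).comp ((WithLp.measurable_ofLp 2 _).comp hΦ)

/-- **A jointly measurable version of `(ω, ξ) ↦ 𝓕(A_{i,ω} u)(ξ)`**: the explicit function of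
`fourierFn_slot_ae_eq` is measurable on `Ω × ℝ³`. [folklore] -/
theorem measurable_fourierSlotFn (u : L2C) :
    Measurable fun q : 𝒟.Ω × EuclideanSpace ℝ (Fin 3) =>
      Set.indicator {0}ᶜ (𝒟.m i q.1) q.2 •
        complexifyCLM (𝒟.R i q.1).toLinearIsometry.toContinuousLinearMap
          (((((𝒟.lam i q.1)⁻¹ ^ (3 / 2 : ℝ) : ℝ)) : ℂ) •
            fourierFn u ((𝒟.lam i q.1)⁻¹ • (𝒟.R i q.1).symm q.2)) := by
  have hlam : Measurable fun q : 𝒟.Ω × EuclideanSpace ℝ (Fin 3) => (𝒟.lam i q.1)⁻¹ :=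
    ((𝒟.measurable_lam i).comp measurable_fst).inv
  refine (𝒟.measurable_symbol_indicator i).smul (𝒟.measurable_complexifyCLM_apply i ?_)
  refine (Complex.measurable_ofReal.comp (hlam.pow_const _)).smul ?_
  exact (Lp.stronglyMeasurable (𝓕 u : L2C)).measurable.comp
    (hlam.smul (𝒟.measurable_symm_apply i))

/-! ### Measurability of the averaged Euler integrand -/

/-- **The integrand of (1.13)/(3.4) is measurable in `ω`**: for a complex averaging datum and
`u, v, w ∈ L²`, `ω ↦ ⟨B(A_{1,ω} u, A_{2,ω} v), A_{3,ω} w⟩` (with `⟨B(·,·), ·⟩ = eulerForm`, the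
Bochner rendering of (1.3)) is a.e. strongly measurable on `(Ω, μ)` — indeed strongly
measurable: it is the parametric integral over `ℝ³ × ℝ³` of the jointly measurable function
`(ω, ξ₁, ξ₂) ↦ Λ(F₁(ω,ξ₁), F₂(ω,ξ₂), F₃(ω,-ξ₁-ξ₂))`, `Fᵢ` the measurable versions of
`𝓕(A_{i,ω} ·)` (Tao takes the measurability of (1.13) as read, given "measurable maps"
`R_{i,·}`, `λ_{i,·}`, `m_{i,·}(D)`, p. 6). [cite: Tao2016AveragedNS, §1.1 (1.13) p. 6 and Def. 3.4] -/
theorem aestronglyMeasurable_eulerForm_slot (u v w : L2C) :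
    AEStronglyMeasurable
      (fun θ => eulerForm (𝒟.slot 0 θ u) (𝒟.slot 1 θ v) (𝒟.slot 2 θ w)) 𝒟.μ := by
  -- the jointly measurable versions of the three Fourier-side slots
  set F : Fin 3 → L2C → 𝒟.Ω × EuclideanSpace ℝ (Fin 3) → EuclideanSpace ℂ (Fin 3) :=
    fun j x q => Set.indicator {0}ᶜ (𝒟.m j q.1) q.2 •
      complexifyCLM (𝒟.R j q.1).toLinearIsometry.toContinuousLinearMap
        (((((𝒟.lam j q.1)⁻¹ ^ (3 / 2 : ℝ) : ℝ)) : ℂ) •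
          fourierFn x ((𝒟.lam j q.1)⁻¹ • (𝒟.R j q.1).symm q.2)) with hF
  have hFm : ∀ j x, Measurable (F j x) := fun j x => 𝒟.measurable_fourierSlotFn j x
  have hFae : ∀ j x θ, fourierFn (𝒟.slot j θ x) =ᵐ[volume] fun ξ => F j x (θ, ξ) :=
    fun j x θ => 𝒟.fourierFn_slot_ae_eq j θ x
  -- the jointly measurable integrand on `Ω × (ℝ³ × ℝ³)`
  set H : 𝒟.Ω × (EuclideanSpace ℝ (Fin 3) × EuclideanSpace ℝ (Fin 3)) → ℂ :=
    fun q => Λ q.2.1 q.2.2 (F 0 u (q.1, q.2.1)) (F 1 v (q.1, q.2.2))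
      (F 2 w (q.1, -q.2.1 - q.2.2)) with hH
  have hHm : Measurable H := by
    have heq : H = (fun r : (EuclideanSpace ℝ (Fin 3) × EuclideanSpace ℝ (Fin 3)) ×
        (EuclideanSpace ℂ (Fin 3) × EuclideanSpace ℂ (Fin 3) × EuclideanSpace ℂ (Fin 3)) =>
          Λ r.1.1 r.1.2 r.2.1 r.2.2.1 r.2.2.2) ∘
        fun q : 𝒟.Ω × (EuclideanSpace ℝ (Fin 3) × EuclideanSpace ℝ (Fin 3)) =>
          (q.2, (F 0 u (q.1, q.2.1), F 1 v (q.1, q.2.2), F 2 w (q.1, -q.2.1 - q.2.2))) := rfl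
    rw [heq]
    refine continuous_Λ.measurable.comp (measurable_snd.prodMk ((((hFm 0 u).comp
      (measurable_fst.prodMk (measurable_fst.comp measurable_snd))).prodMk
      (((hFm 1 v).comp (measurable_fst.prodMk (measurable_snd.comp measurable_snd))).prodMk
      ((hFm 2 w).comp (measurable_fst.prodMk ?_))))))
    exact (measurable_fst.comp measurable_snd).neg.sub (measurable_snd.comp measurable_snd)
  -- its parametric integral is strongly measurable in `θ` …
  have hint : StronglyMeasurable fun θ => ∫ p, H (θ, p) :=
    hHm.stronglyMeasurable.integral_prod_right'
  -- … and equals the Euler form of the slots for every `θ`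
  have heq : (fun θ => eulerForm (𝒟.slot 0 θ u) (𝒟.slot 1 θ v) (𝒟.slot 2 θ w)) =
      fun θ => -(Real.pi * I) * ∫ p, H (θ, p) := by
    funext θ
    unfold eulerForm
    congr 1
    refine integral_congr_ae ?_
    have e1 := (Measure.quasiMeasurePreserving_fst (μ := (volume : Measure
      (EuclideanSpace ℝ (Fin 3)))) (ν := (volume : Measure (EuclideanSpace ℝ (Fin 3))))).ae_eq
      (hFae 0 u θ)
    have e2 := (Measure.quasiMeasurePreserving_snd (μ := (volume : Measure
      (EuclideanSpace ℝ (Fin 3)))) (ν := (volume : Measure (EuclideanSpace ℝ (Fin 3))))).ae_eq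
      (hFae 1 v θ)
    have e3 := quasiMeasurePreserving_neg_fst_sub_snd.ae_eq (hFae 2 w θ)
    rw [Measure.volume_eq_prod]
    filter_upwards [e1, e2, e3] with p h1 h2 h3
    simp only [Function.comp_apply] at h1 h2 h3
    rw [h1, h2, h3]
  rw [heq]
  exact (hint.const_mul _).aestronglyMeasurable

end ComplexAveragingDatum

end Literature.Analysis.FluidPDE.Tao2016
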